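import Summits.Ventures.HodgeRepro2.Sextic
import Summits.Ventures.HodgeRepro2.CyclotomicSeven
import Summits.Ventures.HodgeRepro2.T5CubeTypes

/-!
# T5CMFrameDictionary — CM frames (p3) ↔ injective CM-type triples (p1); the cube of CM types

Kernel dictionary (seat p3, Tier-5 support) between two independent formalisations of the same
object of the record — «the CM types τ₁, τ₂, τ₃ of the sextic field», T4N §1 / N2.1:
`T5CubeTypes.IsCMFrame τ` (files 58 / 59, the hypothesis of `lemma_N2_datum` and
`lemma_N2_complete`) and p1's `Function.Injective τ ∧ IsCMType K (Set.range τ)` (Sextic.lean,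
CyclotomicSeven.lean). It closes the prose item «that the record's τ₁, τ₂, τ₃ form a CM frame of
the sextic field» of my annex §26–§27:

* `isCMFrame_iff` — `IsCMFrame τ ↔ Function.Injective τ ∧ IsCMType K (Set.range τ)`, with NO
  degree hypothesis (the exhaustiveness of τ_ν, τ̄_ν is forced by the CM-type condition on the
  range, p1's `exists_eq_or_eq_conjugate`).
* `cubeType_eq` — my `T5CubeTypes.cubeType` and p1's `cubeType` are the same term (`rfl`).
* `isCMType_iff_exists_cubeType` / `ncard_setOf_isCMType` — for a CM frame the CM types of `K` are
  exactly the 8 cube vertices `cubeType τ b`, `b : Fin 3 → Bool` (the brief's «cube of CM types»),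
  and `ncard_cubeType` — every vertex has exactly 3 embeddings.
* `finrank_eq_six_of_isCMFrame` / `exists_isCMFrame_iff` — a CM frame exists on a CM number field
  iff `[K : ℚ] = 6` (the six embeddings τ_ν, τ̄_ν are a bijection `Fin 3 × Bool ≃ (K →+* ℂ)`;
  the converse is p1's `CyclotomicSeven.exists_cmType_triple`).

Nothing new is proved about the datum; labels and printed inputs untouched.

Header declaration (README §8(d)): uses an L-value-free non-vanishing device: **no**.
-/

namespace Summit.Ventures.HodgeRepro2.T5CMFrameDictionary

open T5CubeTypes NumberField.ComplexEmbedding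

variable {K : Type*} [Field K]

/-- The range of a CM frame is a CM type: every embedding is exactly one of `τ ν`, `τ̄ ν`. -/
theorem isCMType_range_of_isCMFrame {τ : Fin 3 → K →+* ℂ} (hτ : IsCMFrame τ) :
    IsCMType K (Set.range τ) := by
  intro φ
  obtain ⟨ν, hν | hν⟩ := hτ.exhaustive φ
  · subst hν
    refine Or.inl ⟨⟨ν, rfl⟩, ?_⟩
    rintro ⟨μ, hμ⟩
    exact hτ.ne_conjugate μ ν hμ
  · subst hν
    refine Or.inr ⟨⟨ν, by simp⟩, ?_⟩
    rintro ⟨μ, hμ⟩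
    exact hτ.ne_conjugate μ ν hμ

/-- An injective triple with CM-type range is a CM frame (p1's `ne_conjugate_of_isCMType` and
`exists_eq_or_eq_conjugate` supply the two remaining fields). -/
theorem isCMFrame_of_injective_isCMType {τ : Fin 3 → K →+* ℂ} (hinj : Function.Injective τ)
    (hcm : IsCMType K (Set.range τ)) : IsCMFrame τ :=
  ⟨hinj, ne_conjugate_of_isCMType hcm, exists_eq_or_eq_conjugate hcm⟩

/-- DICTIONARY: `IsCMFrame τ` (p3) is `Function.Injective τ ∧ IsCMType K (Set.range τ)` (p1);
no degree hypothesis on either side. -/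
theorem isCMFrame_iff {τ : Fin 3 → K →+* ℂ} :
    IsCMFrame τ ↔ Function.Injective τ ∧ IsCMType K (Set.range τ) :=
  ⟨fun hτ => ⟨hτ.injective, isCMType_range_of_isCMFrame hτ⟩,
   fun h => isCMFrame_of_injective_isCMType h.1 h.2⟩

/-- The two `cubeType`s are the same term. -/
theorem cubeType_eq (τ : Fin 3 → K →+* ℂ) (b : Fin 3 → Bool) :
    T5CubeTypes.cubeType τ b = cubeType τ b := rfl

/-- The vertex `τ` itself is the cube vertex `111`. -/
theorem range_eq_cubeType (τ : Fin 3 → K →+* ℂ) :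
    Set.range τ = T5CubeTypes.cubeType τ (fun _ => true) := by
  simp [T5CubeTypes.cubeType]

/-- For a CM frame, `cubeType τ` is injective in the vertex (p1's `cubeType_injective`). -/
theorem cubeType_injective_of_isCMFrame {τ : Fin 3 → K →+* ℂ} (hτ : IsCMFrame τ) :
    Function.Injective (T5CubeTypes.cubeType τ) :=
  cubeType_injective hτ.injective (isCMType_range_of_isCMFrame hτ)

/-- THE CUBE OF CM TYPES: for a CM frame `τ`, the CM types of `K` are exactly the eight vertices
`cubeType τ b`. -/
theorem isCMType_iff_exists_cubeType {τ : Fin 3 → K →+* ℂ} (hτ : IsCMFrame τ)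
    {Φ : Set (K →+* ℂ)} : IsCMType K Φ ↔ ∃ b : Fin 3 → Bool, Φ = T5CubeTypes.cubeType τ b := by
  constructor
  · intro hΦ
    exact ⟨_, eq_cubeType_of_isCMType hτ.injective (isCMType_range_of_isCMFrame hτ) hΦ⟩
  · rintro ⟨b, rfl⟩
    exact T5CubeTypes.isCMType_cubeType hτ b

/-- The set of CM types of `K` is the range of `cubeType τ`. -/
theorem setOf_isCMType_eq_range {τ : Fin 3 → K →+* ℂ} (hτ : IsCMFrame τ) :
    {Φ : Set (K →+* ℂ) | IsCMType K Φ} = Set.range (T5CubeTypes.cubeType τ) := by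
  ext Φ
  simp only [Set.mem_setOf_eq, Set.mem_range]
  rw [isCMType_iff_exists_cubeType hτ]
  constructor <;> rintro ⟨b, h⟩ <;> exact ⟨b, h.symm⟩

/-- A CM field carrying a CM frame has exactly `8 = 2³` CM types. -/
theorem ncard_setOf_isCMType {τ : Fin 3 → K →+* ℂ} (hτ : IsCMFrame τ) :
    {Φ : Set (K →+* ℂ) | IsCMType K Φ}.ncard = 8 := by
  rw [setOf_isCMType_eq_range hτ, Set.ncard_range_of_injective (cubeType_injective_of_isCMFrame hτ),
    Nat.card_eq_fintype_card]
  simp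

/-- The six embeddings of a CM frame, indexed by `(ν, b)`: `τ ν` for `b = true`, `τ̄ ν` for
`b = false`. -/
def frameEmb (τ : Fin 3 → K →+* ℂ) : Fin 3 × Bool → (K →+* ℂ) :=
  fun p => if p.2 then τ p.1 else conjugate (τ p.1)

/-- `frameEmb τ (ν, true) = τ ν`. -/
@[simp] theorem frameEmb_true (τ : Fin 3 → K →+* ℂ) (ν : Fin 3) : frameEmb τ (ν, true) = τ ν := rfl

/-- `frameEmb τ (ν, false) = τ̄ ν`. -/
@[simp] theorem frameEmb_false (τ : Fin 3 → K →+* ℂ) (ν : Fin 3) :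
    frameEmb τ (ν, false) = conjugate (τ ν) := rfl

/-- For a CM frame the six embeddings `τ ν`, `τ̄ ν` are pairwise distinct. -/
theorem frameEmb_injective {τ : Fin 3 → K →+* ℂ} (hτ : IsCMFrame τ) :
    Function.Injective (frameEmb τ) := by
  rintro ⟨ν, b⟩ ⟨μ, c⟩ h
  cases b <;> cases c <;> simp only [frameEmb_true, frameEmb_false] at h
  · have : τ ν = τ μ := by
      have := congrArg conjugate h
      simpa using this
    rw [hτ.injective this]
  · exact absurd h.symm (hτ.ne_conjugate μ ν)
  · exact absurd h (hτ.ne_conjugate ν μ)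
  · rw [hτ.injective h]

/-- For a CM frame the six embeddings `τ ν`, `τ̄ ν` exhaust `K →+* ℂ`. -/
theorem frameEmb_surjective {τ : Fin 3 → K →+* ℂ} (hτ : IsCMFrame τ) :
    Function.Surjective (frameEmb τ) := by
  intro φ
  obtain ⟨ν, h | h⟩ := hτ.exhaustive φ
  · exact ⟨(ν, true), h.symm⟩
  · exact ⟨(ν, false), h.symm⟩

/-- `Fin 3 × Bool ≃ (K →+* ℂ)` for a CM frame. -/
theorem frameEmb_bijective {τ : Fin 3 → K →+* ℂ} (hτ : IsCMFrame τ) :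
    Function.Bijective (frameEmb τ) :=
  ⟨frameEmb_injective hτ, frameEmb_surjective hτ⟩

/-- Every cube vertex has exactly three embeddings (no degree hypothesis; cf. p1's
`CyclotomicSeven.ncard_cmType_eq_three` for `[K : ℚ] = 6`). -/
theorem ncard_cubeType {τ : Fin 3 → K →+* ℂ} (hτ : IsCMFrame τ) (b : Fin 3 → Bool) :
    (T5CubeTypes.cubeType τ b).ncard = 3 := by
  have hinj : Function.Injective (fun ν => frameEmb τ (ν, b ν)) := by
    intro ν μ h
    have := frameEmb_injective hτ h
    exact (Prod.mk.inj this).1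
  have heq : T5CubeTypes.cubeType τ b = Set.range (fun ν => frameEmb τ (ν, b ν)) := rfl
  rw [heq, Set.ncard_range_of_injective hinj, Nat.card_eq_fintype_card, Fintype.card_fin]

section Sextic

variable [NumberField K]

/-- A CM frame forces exactly six complex embeddings. -/
theorem card_embeddings_eq_six_of_isCMFrame {τ : Fin 3 → K →+* ℂ} (hτ : IsCMFrame τ) :
    Fintype.card (K →+* ℂ) = 6 := by
  rw [← Fintype.card_of_bijective (frameEmb_bijective hτ)]
  simp

/-- A CM frame forces `[K : ℚ] = 6` (Mathlib `NumberField.Embeddings.card`). -/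
theorem finrank_eq_six_of_isCMFrame {τ : Fin 3 → K →+* ℂ} (hτ : IsCMFrame τ) :
    Module.finrank ℚ K = 6 := by
  rw [← NumberField.Embeddings.card K ℂ]
  exact card_embeddings_eq_six_of_isCMFrame hτ

/-- Every sextic CM field carries a CM frame (p1's `CyclotomicSeven.exists_cmType_triple` read
through the dictionary). -/
theorem exists_isCMFrame [NumberField.IsCMField K] (h6 : Module.finrank ℚ K = 6) :
    ∃ τ : Fin 3 → K →+* ℂ, IsCMFrame τ := by
  obtain ⟨τ, hinj, hcm⟩ := CyclotomicSeven.exists_cmType_triple K h6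
  exact ⟨τ, isCMFrame_of_injective_isCMType hinj hcm⟩

/-- A CM number field carries a CM frame iff it is sextic. -/
theorem exists_isCMFrame_iff [NumberField.IsCMField K] :
    (∃ τ : Fin 3 → K →+* ℂ, IsCMFrame τ) ↔ Module.finrank ℚ K = 6 :=
  ⟨fun ⟨_, hτ⟩ => finrank_eq_six_of_isCMFrame hτ, exists_isCMFrame⟩

/-- Over a sextic CM field every CM type is a cube vertex of a frame obtained by enumerating it:
the record's «τ₁, τ₂, τ₃ ∈ Φ₁₁₁» is the choice of such an enumeration. -/
theorem exists_isCMFrame_range_eq [NumberField.IsCMField K] (h6 : Module.finrank ℚ K = 6)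
    {Φ : Set (K →+* ℂ)} (hΦ : IsCMType K Φ) :
    ∃ τ : Fin 3 → K →+* ℂ, IsCMFrame τ ∧ Set.range τ = Φ := by
  obtain ⟨τ₀, hτ₀⟩ := exists_isCMFrame h6
  obtain ⟨b, rfl⟩ := (isCMType_iff_exists_cubeType hτ₀).1 hΦ
  refine ⟨fun ν => frameEmb τ₀ (ν, b ν), ?_, rfl⟩
  exact isCMFrame_of_injective_isCMType
    (fun ν μ h => (Prod.mk.inj (frameEmb_injective hτ₀ h)).1)
    (T5CubeTypes.isCMType_cubeType hτ₀ b)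

end Sextic

end Summit.Ventures.HodgeRepro2.T5CMFrameDictionary
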